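import Literature.NumberTheory.EllipticCurves.KatoRankBoundSelmerProofs
import Literature.NumberTheory.EllipticCurves.IwasawaLeadingTerm
import HarnessLib

/-!
# Skinner–Urban 2014 Thm 3.6.9 (integral clause) + Perrin-Riou–Schneider ⇒ the exact `p`-adic
# valuation of `#Ш(E/ℚ)[p^∞]` from the leading term of `L_p(E,T)` (per-curve assembly, PROVED from
# the two named facts; no new fact)

HONEST FRAMING (cell `b2b-bsdr2sha`, home `run/shared/lean/b2b/bsd-rank2-sha/`, seat LIT-1;
Literature = cited statements and their kernel-checked consequences only). This file COMBINES two
named facts of the tree, both published theorems taken as hypotheses — bsd.S21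
`skinner_urban_main_conjecture W p` (C. Skinner, E. Urban, Invent. Math. 195 (2014), Thm. 3.6.9,
p. 45 of the author version: under good ordinary `p ≥ 3`, `ρ̄_{E,p}` irreducible, a prime `q ‖ N`,
`q ≠ p`, with `ρ̄_{E,p}` ramified at `q`, "F_E = (L_E) in Λ_ℚ ⊗ ℚ_p. If the image of ρ_{E,p} is
surjective, then this equality holds in Λ_ℚ") and `Schneider1985_order_charGenerator`
(Perrin-Riou–Schneider as printed by Balakrishnan–Müller–Stein, Math. Comp. 85 (2016), Thm. 1.7:
`ord_{T=0} f_E ≥ r`, `= r` iff `Reg_p ≠ 0 ∧ Ш(p) finite`, and then the leading coefficient of `f_E`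
is `ε_p · #Ш(p) · Reg_γ · ∏ c_v / #E(ℚ)_tors²` up to `ℤ_pˣ`) — into the statement a census row of
the cell needs for "`#Ш(E/ℚ)[p^∞] = p^k`": for ONE curve and ONE prime, given a certified
`ord_{T=0} L_p(E,T) ≤ rank E(ℚ)`, the conclusions `Ш(E/ℚ)[p^∞]` finite, `Reg_p(E) ≠ 0` (Schneider's
conjecture at `p` for the canonical height), `ord_{T=0} L_p(E,T) = rank E(ℚ)`, and the EXACT identity
`[T^r] L_p(E,T) · log_p(γ_cyc)^r · (#E(ℚ)_tors)² = u · (1 − α⁻¹)² · #Ш(E/ℚ)[p^∞] · Reg_p · ∏_v c_v`,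
`u ∈ ℤ_pˣ` — Stein–Wuthrich's `b_p` (Math. Comp. 82 (2013), Algorithm 11.1 (4)–(5), p. 27 and
Prop. 11.2, p. 28: "If Conjecture 7.1 [the main conjecture] holds then the result of the algorithm is
equal to the order of Ш(E/ℚ)(p)") with EQUALITY. It asserts nothing about BSD and books no row;
theorems only (0 new `Prop` definitions, debt delta 0).

## The argument (S–W 2013 §8/§11 read with S–U 3.6.9 in place of one-sided divisibility)

With `ρ_{E,p}` onto `GL₂(ℤ_p)` (tree binder `∀ n, W.HasSurjectiveModNGaloisRep (p^n)` = Kato's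
(12.5.2), `Kato2004.imageContainsSL2_iff_forall_hasSurjectiveModNGaloisRep`), S–U 3.6.9 gives a
generator `g ∈ Λ = ℤ_p⟦T⟧` of `char_Λ X(E/ℚ_∞)` with `ι g = L_p(E,T)` on the nose (`ι : Λ ↪ ℚ_p⟦T⟧`
coefficientwise). Hence `ord_{T=0} g = ord_{T=0} L_p` (`order_iwasawaToPowerSeries`) and
`[T^r] g = [T^r] L_p`. PRS clause 1 gives `r ≤ ord g`; the certified `ord L_p ≤ r` closes
`ord g = r`, so PRS clause 2 yields `Reg_p ≠ 0` AND `Ш[p^∞]` finite, and clause 3 the leading-term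
identity, in which `[T^r] g` is replaced by `[T^r] L_p(E,T)`. (For FINITENESS alone neither S–U nor
PRS is needed — Kato's Thm. 18.4 suffices, file `Kato2004/ShaFiniteOfOrderLeRankProofs.lean`; the
present file is the EXACT-ORDER half, which needs the integral equality, i.e. all of H0–H5 of the
cell's typing sheet `lit/KATO-SU-AS-PRINTED.md` §4, and `p ≥ 5` because the tree's PRS fact and
canonical height are typed for `p ≥ 5`.)

## What is here (all PROVED)

* `order_iwasawaToPowerSeries`, `coeff_iwasawaToPowerSeries` — `ι : Λ ↪ ℚ_p⟦T⟧` preserves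
  `ord_{T=0}` and coefficients (bookkeeping).
* `sha_finite_schneider_leadingTerm_of_mainConjecture` — the assembly with all Iwasawa data
  explicit (`κ, γ, D`), from `skinner_urban_main_conjecture W p` at these data and
  `Schneider1985_order_charGenerator`.
* `sha_finite_schneider_leadingTerm_of_mainConjecture'` — the ROW SHAPE: the cyclotomic data and
  the dual Selmer datum are discharged by the tree's existence theorems
  (`exists_isCyclotomic_isTopGenerator_isCyclotomicVariable_holds`, `nonempty_selmerDualData_holds`,
  finite generation `module_finite_of_finite_pTorsion_invariants`), so the statement mentions only
  `W, p, f`, the canonical height datum `Dh` and the certificate `ord_{T=0} L_p ≤ rank` (or a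
  non-zero `T^n`-coefficient with `n ≤ rank`, `…_of_coeff_ne_zero`).

## References

* C. Skinner, E. Urban, Invent. Math. 195 (2014) 1–277: Thm. 3.6.9 (author version p. 45), §3.6.7.
  [SkinnerUrban2014]
* J. S. Balakrishnan, J. S. Müller, W. A. Stein, Math. Comp. 85 (2016), Thm. 1.7 (Perrin-Riou,
  Schneider). [BalakrishnanMullerStein2015] — P. Schneider, Invent. Math. 79 (1985). [Schneider1985]
* W. Stein, C. Wuthrich, Math. Comp. 82 (2013): Thm. 6.1 (p. 20), §7 Thm. 7.5 (p. 22), Algorithm 11.1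
  and Prop. 11.2 (pp. 27–28), remark p. 29. [SteinWuthrich2013]
* K. Kato, Astérisque 295 (2004), Thm. 17.4 (the divisibility inside S–U 3.6.9). [Kato2004Asterisque]
-/

noncomputable section

open scoped Classical MatrixGroups ModularForm

open CongruenceSubgroup WeierstrassCurve Literature.NumberTheory.EllipticCurves.ModularForms

namespace Literature.NumberTheory.EllipticCurves

/-! ### `ι : Λ ↪ ℚ_p⟦T⟧` preserves the order of vanishing and the coefficients -/

section OrderMap

variable (p : ℕ) [Fact p.Prime]

/-- The `n`-th coefficient of `ι g` is the `n`-th coefficient of `g ∈ Λ = ℤ_p⟦T⟧` viewed in `ℚ_p`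
(`ι` is coefficientwise `ℤ_p ↪ ℚ_p`; Mazur–Tate–Teitelbaum 1986, §I.12). [cite: MazurTateTeitelbaum1986, §I.12] -/
theorem coeff_iwasawaToPowerSeries (g : IwasawaAlgebra p) (n : ℕ) :
    PowerSeries.coeff n (iwasawaToPowerSeries p g) = ((PowerSeries.coeff n g : ℤ_[p]) : ℚ_[p]) := by
  rw [iwasawaToPowerSeries, PowerSeries.coeff_map, PadicInt.algebraMap_apply]

/-- `ι : Λ ↪ ℚ_p⟦T⟧` preserves `ord_{T=0}`: `ord_{T=0} (ι g) = ord_{T=0} g` (coefficientwise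
injective map). [cite: MazurTateTeitelbaum1986, §I.12] -/
theorem order_iwasawaToPowerSeries (g : IwasawaAlgebra p) :
    (iwasawaToPowerSeries p g).order = g.order := by
  refine le_antisymm ?_ (PowerSeries.le_order_map _)
  by_cases hg : g = 0
  · subst hg
    simp
  · have hc : PowerSeries.coeff g.order.toNat g ≠ 0 := PowerSeries.coeff_order hg
    have hc' : PowerSeries.coeff g.order.toNat (iwasawaToPowerSeries p g) ≠ 0 := by
      rw [coeff_iwasawaToPowerSeries, ne_eq, PadicInt.coe_eq_zero]
      exact hc
    calc (iwasawaToPowerSeries p g).order ≤ (g.order.toNat : ℕ∞) := PowerSeries.order_le _ hc'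
      _ = g.order := PowerSeries.coe_toNat_order hg

end OrderMap

/-! ### The assembly: S–U 3.6.9 (integral) + Perrin-Riou–Schneider -/

section Assembly

variable (W : WeierstrassCurve ℚ) [W.IsElliptic] [W.IsGloballyMinimal] (p : ℕ) [Fact p.Prime]
  {N : ℕ} [NeZero N] {f : CuspForm (Gamma0 N) 2}

/-- **Exact order of `Ш(E/ℚ)[p^∞]` from the integral main conjecture and Perrin-Riou–Schneider, all
Iwasawa data explicit.** Inputs: the named facts bsd.S21 `skinner_urban_main_conjecture W p` (at the
cyclotomic data `κ, γ` and the newform `f`; S–U 2014 Thm. 3.6.9) and `Schneider1985_order_charGenerator`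
(BMS 2016 Thm. 1.7); a prime `p ≥ 5` of good ordinary reduction (`hgood`, `hord`); S–U's hypotheses
`ρ̄_{E,p}` irreducible (`hirr`), a multiplicative prime `ℓ ≠ p` with `p ∤ v_ℓ(Δ_min)` (`haux`, i.e.
`ρ̄_{E,p}` ramified at `ℓ ‖ N`) and `ρ_{E,p}` onto `GL₂(ℤ_p)` (`hsurj`, for the equality in `Λ`);
the cyclotomic `ℤ_p`-extension `κ` with generator `γ` matching the variable of `L_p`; a dual Selmer
datum `D` (finitely generated over `Λ`); THE canonical `p`-adic height `Dh`; and the certificate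
`ord_{T=0} L_p(E,T) ≤ rank E(ℚ)`. Conclusions: `Ш(E/ℚ)[p^∞]` is finite; `Reg_p(E, Dh) ≠ 0`
(`SchneiderConjecture Dh`); `ord_{T=0} L_p(E,T) = rank E(ℚ) =: r`; and for some `u ∈ ℤ_pˣ`,
`[T^r] L_p(E,T) · log_p(γ_cyc)^r · (#E(ℚ)_tors)² = u · (1 − α⁻¹)² · #Ш(E/ℚ)[p^∞] · Reg_p(E,Dh) · ∏_v c_v`
(`α = unitRoot W p`, `γ_cyc = cyclotomicGenerator p = 1 + p`). This is Stein–Wuthrich 2013,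
Algorithm 11.1 (4)–(5) / Prop. 11.2 with equality ("If Conjecture 7.1 holds then the result of the
algorithm is equal to the order of Ш(E/ℚ)(p)"), the main conjecture being supplied by S–U 3.6.9.
[cite: SkinnerUrban2014, Thm. 3.6.9 (p. 45)] [cite: BalakrishnanMullerStein2015, Thm. 1.7]
[cite: SteinWuthrich2013, Algorithm 11.1 and Prop. 11.2 (pp. 27–28)] -/
theorem sha_finite_schneider_leadingTerm_of_mainConjecture
    {κ : ZpExtension ℚ p} {γ : Field.absoluteGaloisGroup ℚ}
    (hSU : skinner_urban_main_conjecture W p (κ := κ) (γ := γ) (f := f))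
    (hS : Schneider1985_order_charGenerator)
    (hp : 5 ≤ p) (hgood : W.HasGoodReductionAtPrime p) (hord : ¬ (p : ℤ) ∣ W.frobeniusTrace p)
    (hirr : W.HasIrreducibleModPGaloisRep p)
    (haux : ∃ ℓ : ℕ, ∃ _ : Fact ℓ.Prime, ℓ ≠ p ∧ W.HasMultiplicativeReductionAtPrime ℓ ∧
      ¬ p ∣ padicValInt ℓ W.minimalDiscriminantInt)
    (hsurj : ∀ n : ℕ, W.HasSurjectiveModNGaloisRep (p ^ n : ℕ))
    (hκ : κ.IsCyclotomic) (hγ : κ.IsTopGenerator γ) (hγ' : IsCyclotomicVariable p γ)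
    (hf : IsNewformOf W f) (D : W.SelmerDualData κ γ) [Module.Finite (IwasawaAlgebra p) D.X]
    (Dh : PAdicHeightData W p) (hDh : Dh.IsCanonical)
    (hle : (padicLFunction f (unitRoot W p : ℚ_[p])).order ≤ (W.mordellWeilRank : ℕ∞)) :
    Finite (AddCommGroup.primaryComponent W.sha p) ∧ SchneiderConjecture Dh ∧
      (padicLFunction f (unitRoot W p : ℚ_[p])).order = W.mordellWeilRank ∧
      ∃ u : ℤ_[p]ˣ,
        PowerSeries.coeff W.mordellWeilRank (padicLFunction f (unitRoot W p : ℚ_[p])) *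
            padicLog p (cyclotomicGenerator p) ^ W.mordellWeilRank *
            (W.torsionOrder : ℚ_[p]) ^ 2 =
          ((u : ℤ_[p]) : ℚ_[p]) *
            ((1 - (unitRoot W p : ℚ_[p])⁻¹) ^ 2 *
              ((Nat.card (AddCommGroup.primaryComponent W.sha p) : ℚ_[p]) *
                padicRegulator Dh * W.tamagawaProduct)) := by
  have hp3 : 3 ≤ p := le_trans (by norm_num) hp
  obtain ⟨htors, -, hint⟩ := hSU hp3 hgood hord hirr haux hκ hγ hγ' hf D
  obtain ⟨g, hιg, hchar⟩ := hint hsurj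
  obtain ⟨h1, h2, h3⟩ := hS W p hp hgood hord κ γ hκ hγ hγ' D htors g hchar Dh hDh
  -- `ord g = ord L_p`
  have hog : g.order = (padicLFunction f (unitRoot W p : ℚ_[p])).order := by
    rw [← order_iwasawaToPowerSeries p g, hιg]
  have hle' : g.order ≤ (W.mordellWeilRank : ℕ∞) := hog ▸ hle
  have heq : g.order = W.mordellWeilRank := le_antisymm hle' h1
  obtain ⟨hSch, hfin⟩ := h2.mp heq
  obtain ⟨u, hu⟩ := h3 hSch hfin
  refine ⟨hfin, hSch, hog ▸ heq, u, ?_⟩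
  rw [← hιg, coeff_iwasawaToPowerSeries]
  exact hu

/-- **The census row shape (exact order of `Ш[p^∞]`).** As
`sha_finite_schneider_leadingTerm_of_mainConjecture`, with the cyclotomic `ℤ_p`-extension, its
generator and the dual Selmer datum DISCHARGED by the tree's existence theorems, and the main
conjecture bsd.S21 taken for all cyclotomic data (as bsd.S20 is in
`kato_selmerCorank_le_order_padicLFunction_of_kato_divisibility`). Inputs a row must supply: `p ≥ 5`
good ordinary (H0–H2), `ρ̄_{E,p}` irreducible (H3), a multiplicative `ℓ ≠ p` with `p ∤ v_ℓ(Δ_min)`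
(H4), `ρ_{E,p}` onto `GL₂(ℤ_p)` (H5), the newform `f`, THE canonical height `Dh`, and
`ord_{T=0} L_p(E,T) ≤ rank E(ℚ)`. Output: `Ш[p^∞]` finite, `Reg_p ≠ 0`, `ord_{T=0} L_p = rank`, and
the unit equation fixing `ord_p #Ш(E/ℚ)[p^∞] = ord_p [T^r]L_p + r·ord_p log_p(γ_cyc) + 2 ord_p #E(ℚ)_tors
− ord_p (1 − α⁻¹)² − ord_p Reg_p − ord_p ∏ c_v` (every term exact in `ℚ_p`).
[cite: SkinnerUrban2014, Thm. 3.6.9 (p. 45)] [cite: BalakrishnanMullerStein2015, Thm. 1.7]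
[cite: SteinWuthrich2013, Prop. 11.2 (p. 28)] -/
theorem sha_finite_schneider_leadingTerm_of_mainConjecture'
    (hSU : ∀ (κ : ZpExtension ℚ p) (γ : Field.absoluteGaloisGroup ℚ),
      skinner_urban_main_conjecture W p (κ := κ) (γ := γ) (f := f))
    (hS : Schneider1985_order_charGenerator)
    (hp : 5 ≤ p) (hgood : W.HasGoodReductionAtPrime p) (hord : ¬ (p : ℤ) ∣ W.frobeniusTrace p)
    (hirr : W.HasIrreducibleModPGaloisRep p)
    (haux : ∃ ℓ : ℕ, ∃ _ : Fact ℓ.Prime, ℓ ≠ p ∧ W.HasMultiplicativeReductionAtPrime ℓ ∧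
      ¬ p ∣ padicValInt ℓ W.minimalDiscriminantInt)
    (hsurj : ∀ n : ℕ, W.HasSurjectiveModNGaloisRep (p ^ n : ℕ))
    (hf : IsNewformOf W f) (Dh : PAdicHeightData W p) (hDh : Dh.IsCanonical)
    (hle : (padicLFunction f (unitRoot W p : ℚ_[p])).order ≤ (W.mordellWeilRank : ℕ∞)) :
    Finite (AddCommGroup.primaryComponent W.sha p) ∧ SchneiderConjecture Dh ∧
      (padicLFunction f (unitRoot W p : ℚ_[p])).order = W.mordellWeilRank ∧
      ∃ u : ℤ_[p]ˣ,
        PowerSeries.coeff W.mordellWeilRank (padicLFunction f (unitRoot W p : ℚ_[p])) *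
            padicLog p (cyclotomicGenerator p) ^ W.mordellWeilRank *
            (W.torsionOrder : ℚ_[p]) ^ 2 =
          ((u : ℤ_[p]) : ℚ_[p]) *
            ((1 - (unitRoot W p : ℚ_[p])⁻¹) ^ 2 *
              ((Nat.card (AddCommGroup.primaryComponent W.sha p) : ℚ_[p]) *
                padicRegulator Dh * W.tamagawaProduct)) := by
  obtain ⟨κ, hκ, γ, hγ, hγ'⟩ := exists_isCyclotomic_isTopGenerator_isCyclotomicVariable_holds p
  obtain ⟨D⟩ := W.nonempty_selmerDualData_holds κ γ hγ
  haveI : Module.Finite (IwasawaAlgebra p) D.X :=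
    D.module_finite_of_finite_pTorsion_invariants W
      (W.finite_selmerInfty_pTorsion_invariants_holds κ γ) hκ hγ
  exact sha_finite_schneider_leadingTerm_of_mainConjecture W p (hSU κ γ) hS hp hgood hord hirr haux
    hsurj hκ hγ hγ' hf D Dh hDh hle

/-- **Certificate variant**: a NON-ZERO `T^n`-coefficient of `L_p(E,T)` with `n ≤ rank E(ℚ)` in
place of `ord_{T=0} L_p ≤ rank`; then moreover `rank E(ℚ) = n`.
[cite: SkinnerUrban2014, Thm. 3.6.9 (p. 45)] [cite: BalakrishnanMullerStein2015, Thm. 1.7]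
[cite: SteinWuthrich2013, Algorithm 11.1 (3)–(5) (pp. 27–28)] -/
theorem sha_finite_schneider_leadingTerm_of_mainConjecture_of_coeff_ne_zero
    (hSU : ∀ (κ : ZpExtension ℚ p) (γ : Field.absoluteGaloisGroup ℚ),
      skinner_urban_main_conjecture W p (κ := κ) (γ := γ) (f := f))
    (hS : Schneider1985_order_charGenerator)
    (hp : 5 ≤ p) (hgood : W.HasGoodReductionAtPrime p) (hord : ¬ (p : ℤ) ∣ W.frobeniusTrace p)
    (hirr : W.HasIrreducibleModPGaloisRep p)
    (haux : ∃ ℓ : ℕ, ∃ _ : Fact ℓ.Prime, ℓ ≠ p ∧ W.HasMultiplicativeReductionAtPrime ℓ ∧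
      ¬ p ∣ padicValInt ℓ W.minimalDiscriminantInt)
    (hsurj : ∀ n : ℕ, W.HasSurjectiveModNGaloisRep (p ^ n : ℕ))
    (hf : IsNewformOf W f) (Dh : PAdicHeightData W p) (hDh : Dh.IsCanonical) {n : ℕ}
    (hcoeff : PowerSeries.coeff n (padicLFunction f (unitRoot W p : ℚ_[p])) ≠ 0)
    (hn : n ≤ W.mordellWeilRank) :
    Finite (AddCommGroup.primaryComponent W.sha p) ∧ SchneiderConjecture Dh ∧
      W.mordellWeilRank = n ∧ (padicLFunction f (unitRoot W p : ℚ_[p])).order = n ∧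
      ∃ u : ℤ_[p]ˣ,
        PowerSeries.coeff n (padicLFunction f (unitRoot W p : ℚ_[p])) *
            padicLog p (cyclotomicGenerator p) ^ n * (W.torsionOrder : ℚ_[p]) ^ 2 =
          ((u : ℤ_[p]) : ℚ_[p]) *
            ((1 - (unitRoot W p : ℚ_[p])⁻¹) ^ 2 *
              ((Nat.card (AddCommGroup.primaryComponent W.sha p) : ℚ_[p]) *
                padicRegulator Dh * W.tamagawaProduct)) := by
  have hord_le : (padicLFunction f (unitRoot W p : ℚ_[p])).order ≤ (n : ℕ∞) :=
    PowerSeries.order_le n hcoeff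
  have hn' : (n : ℕ∞) ≤ (W.mordellWeilRank : ℕ∞) := by exact_mod_cast hn
  obtain ⟨hfin, hSch, hordr, u, hu⟩ :=
    sha_finite_schneider_leadingTerm_of_mainConjecture' W p hSU hS hp hgood hord hirr haux hsurj hf
      Dh hDh (hord_le.trans hn')
  have hrank : W.mordellWeilRank = n := by
    refine le_antisymm ?_ hn
    have : (W.mordellWeilRank : ℕ∞) ≤ (n : ℕ∞) := hordr.symm.le.trans hord_le
    exact_mod_cast this
  refine ⟨hfin, hSch, hrank, by rw [hordr, hrank], u, ?_⟩
  rw [← hrank]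
  exact hu

end Assembly

end Literature.NumberTheory.EllipticCurves

end
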